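import Literature.MathematicalPhysics.QuantumFieldTheory.Balaban1983to89.B13Term214Centred
import Literature.Analysis.SpecialFunctions.RealGaussianComplexLinear
import Literature.MathematicalPhysics.QuantumFieldTheory.Balaban1983to89.B13Representation214

/-!
# `Balaban1983to89.B13Term214GaussShift` — T. Bałaban, *Renormalization group approach to lattice gauge field theories. II.
Cluster expansions*, Commun. Math. Phys. **116** (1988) 1–22 [Balaban1988RG2Cluster], pp. 12–13 (2.5)–(2.6) and p. 15 (2.14):
THE GAUSSIAN TRANSLATION BEHIND (2.5)∕(2.6) CONTINUED TO THE COMPLEX MEASURE OF (2.14) — the generating function of the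
complex measure `dμ_{C^{(k)}(Z₀,σ(Z))}(B)` of (2.14), `∫dμ_{A⁻¹}(B) e^{−⟨B,J⟩} = e^{½⟨J,A⁻¹J⟩}` for a complex SYMMETRIC precision
`A = C^{(k)}(Z₀,σ(Z))⁻¹` with `Re A ≻ 0` and every complex source `J`; hence the compensator `e^{−½⟨ΓX,C^{(k)}(Z₀,σ)ΓX⟩}` of
(2.14) cancels it EXACTLY and lines 2–3 of (2.14) of a field-constant last line ARE that constant, at every admissible complex
`σ(Z)`; hence the `X`-integral of (2.14) of a field-constant last line is that constant and the (2.14) term of a field-constant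
last line VANISHES as soon as one `σ(Δ)`-operation is present (its box-free centre is `0`, not only `b`-free)

statement-level skeleton of published theorems with citation tags; proofs where landed; nothing here is a claim about the
Yang–Mills mass gap

PDF held: `paper:balaban1988-cmp116-rg-ii-cluster` (journal page = PDF page + 0), pp. 12–13, 15 (quoted in `B13Sect2Statements`,
`B13GaugeDevices` §H, `B13Term214`).

CITATION HEADER.  [II] pp. 12–13, (2.5)–(2.6): the conditional Gaussian integral is rewritten by the translation
`Z₀B ↦ Z₀B − C^{(k)}(Z₀)(Z₀C*Δ_kCZ₀ᶜB′)` (*"… we get the equality (2.5) … where dμ_{C^{(k)}(Z₀)} is the Gaussian measure with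
covariance C^{(k)}(Z₀)"*), producing the factor `exp(−½⟨Γ_kX, C^{(k)}(Z₀)Γ_kX⟩)` of (2.6); p. 15, (2.14): the same display at the
complex parameters `σ(Z)` (*"the operators in it are not symmetric, and the second measure is complex"*).  At REAL parameters the
translation is the tree's `B13GaugeDevices.integral_linear_shift` ∕ `ratio_25` (hypothesis-free).  NOT PRINTED as a separate
statement: the generating-function identity at complex `σ(Z)` — print continues (2.5)–(2.6) analytically in `σ` by fiat; what is
recorded here is its proof by real congruence diagonalisation (`Literature.Analysis.SpecialFunctions.RealGaussianComplexLinear`,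
Hörmander *ALPDO I* Thm 7.6.1), with no branch and no identity theorem.

PROVENANCE.  Cell `pub-ymgap`, seat `pub-ymgap-dag-n10-c` (g8), node N10 [B13]; the hypothesis `hmgf` of
`B13Term214Centred.integrand214_const_of_mgf` (lens Card T22, seat `ym-lens-BalabanUVNodes-transfer` g12) is DISCHARGED here;
consumers: node N22's (S-vertex-T′) centre (`B13Term214CentredPieces` §3 proved the box-free centre `b`-free; this file gives its
value), the unseated N09 ∕ Lemma-2 successor.

WHAT IS HERE (no definition).
* §1 `cgaussInt_cexp_neg_dotProduct`, ★ `cgaussMean_cexp_neg_dotProduct` (`∫dμ_{A⁻¹}(B) e^{−⟨B,J⟩} = e^{½⟨J,A⁻¹J⟩}`, `A` complex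
  symmetric, `Re A ≻ 0`, `J ∈ ℂ^Λ`), `cgaussMean_const` (the mean of a constant is the constant).
* §2 ★ `integrand214_const` (lines 2–3 of (2.14) of a field-constant last line `c` equal `c` identically in `X`),
  ★ `core214_constLastLine` (the `X`-integral of (2.14) of a field-constant last line `c(τ)` is `c(τ)` at every `σ` at which
  `A(σ)` is symmetric with positive definite real part).
* §3 ★ `term214_constLastLine_eq_zero` (on the Cauchy polydisc: the (2.14) term of a field-constant last line is `0` whenever
  `Z ∖ Z′₀ ≠ ∅` — the σ-constant annihilation of `B13SigmaFreeKernels.term214_sigmaFree`, here re-derived from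
  `B13Term214.integral_cauchyD_eq_sub` so that no `Node00` object enters this file's imports), `term214_constLastLine_nil`
  (honesty: with no σ-operation the term is the τ-operator of `c`), `F214_one_one_const` (the box-free last line with
  field-constant potentials IS field-constant), ★ `term214_boxFree_eq_zero` (its term vanishes, generic parameter types).
* §4 ★ `term214_torus_windowDilated_boxFree_eq_zero_of_primitives`: on the torus, along the window-dilated family
  `(b²A(σ), bΓ(σ))` of `B13Term214WindowDilated`, the box-free centre of a σ-carrying term is `0` for EVERY `b` of the ball
  `|b − 1| < ρ_b`, from the subset of the PRIMITIVE letters at `b = 1` that makes `Re(b²A(σ)) ≻ 0` (module 41's derivation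
  `posDef_re_of_form` ∘ `hR2_of_entrywise` ∘ `sq_smul_sub_entry_le`, verbatim) — the VALUE of the centre which
  `B13Bound226BoxTail.term214_torus_windowDilated_boxFree_eq_of_primitives` proved `b`-free (no holomorphy in `b` needed here).
HONEST SCOPE.  Classical Gaussian algebra; the symmetry and the positivity of `Re C^{(k)}(Z₀,σ(Z))⁻¹` on the admissible
polydisc are HYPOTHESES (the tree's perturbative regime, `B13FirstEstimate215`); nothing of Bałaban's kernels is constructed;
N10∕N22∕N09 NOT discharged.  No `sorry`, no definition, no new named fact (D-0026).
-/

noncomputable section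

namespace Literature.MathematicalPhysics.QuantumFieldTheory.Balaban1983to89.B13Term214GaussShift

open Matrix MeasureTheory Finset Complex Metric Set
open scoped Real
open B13Term214 (cquad cgaussWeight cgaussInt cgaussNorm cgaussMean integrand214 core214 F214 term214 TopC cauchyD
  TopC_congr integral_cauchyD_eq_sub)
open B13FirstEstimate215 (cquad_eq_dotProduct cgaussNorm_ne_zero)
open B13Term214Centred (integrand214_const_of_mgf)
open Literature.Analysis.SpecialFunctions (integral_cexp_neg_half_quadratic_sub_linear)

variable {Λ : Type} [Fintype Λ] [DecidableEq Λ]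

/-! ## §1. The generating function of the complex measure of (2.14) -/

/-- **`∫dB e^{−½⟨B,AB⟩} e^{−⟨B,J⟩} = e^{½⟨J,A⁻¹J⟩} · ∫dB e^{−½⟨B,AB⟩}`** for a complex symmetric precision `A` with `Re A ≻ 0`
and every complex source `J` — the unnormalised form of the translation behind (2.5)∕(2.6), at the complex parameters of
(2.14) (`Literature.Analysis.SpecialFunctions.integral_cexp_neg_half_quadratic_sub_linear` in the (2.14) vocabulary).
[cite: Balaban1988RG2Cluster, (2.5)–(2.6) pp.12–13, (2.14) p.15] -/
theorem cgaussInt_cexp_neg_dotProduct {A : Matrix Λ Λ ℂ} (hAs : A.IsSymm) (hA : (A.map Complex.re).PosDef)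
    (J : Λ → ℂ) :
    cgaussInt A (fun B => Complex.exp (-((fun i => (B i : ℂ)) ⬝ᵥ J)))
      = Complex.exp ((1 / 2 : ℂ) * (J ⬝ᵥ (A⁻¹ *ᵥ J))) * cgaussNorm A := by
  have e1 : cgaussInt A (fun B => Complex.exp (-((fun i => (B i : ℂ)) ⬝ᵥ J)))
      = ∫ x : Λ → ℝ, cexp (-(1 / 2 : ℂ) * ((fun i => (x i : ℂ)) ⬝ᵥ (A *ᵥ fun i => (x i : ℂ))) -
          (fun i => (x i : ℂ)) ⬝ᵥ J) := by
    unfold cgaussInt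
    refine integral_congr_ae (ae_of_all _ fun x => ?_)
    simp only [cgaussWeight, cquad_eq_dotProduct, ← Complex.exp_add, sub_eq_add_neg]
  have e2 : cgaussNorm A = ∫ x : Λ → ℝ, cexp (-(1 / 2 : ℂ) * ((fun i => (x i : ℂ)) ⬝ᵥ (A *ᵥ fun i => (x i : ℂ)))) := by
    unfold cgaussNorm
    refine integral_congr_ae (ae_of_all _ fun x => ?_)
    simp only [cgaussWeight, cquad_eq_dotProduct]
  rw [e1, e2]
  exact integral_cexp_neg_half_quadratic_sub_linear hAs hA J

/-- **THE GENERATING FUNCTION OF THE COMPLEX MEASURE OF (2.14)**: `∫dμ_{A⁻¹}(B) e^{−⟨B,J⟩} = e^{½⟨J,A⁻¹J⟩}` for a complex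
SYMMETRIC precision `A = C^{(k)}(Z₀,σ(Z))⁻¹` with positive definite real part and every complex source `J` (in (2.14):
`J = Γ_k(Z₀,σ(Z))X`).  At real parameters this is the translation (2.5)∕(2.6) (`B13GaugeDevices.integral_linear_shift` ∕
`ratio_25`); here at the complex ones, where translating the real integration variable is not available
(the normalisation is zero-free: `B13FirstEstimate215.cgaussNorm_ne_zero`). [cite: Balaban1988RG2Cluster, (2.5)–(2.6) pp.12–13, (2.14) p.15] -/
theorem cgaussMean_cexp_neg_dotProduct {A : Matrix Λ Λ ℂ} (hAs : A.IsSymm) (hA : (A.map Complex.re).PosDef)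
    (J : Λ → ℂ) :
    cgaussMean A (fun B => Complex.exp (-((fun i => (B i : ℂ)) ⬝ᵥ J)))
      = Complex.exp ((1 / 2 : ℂ) * (J ⬝ᵥ (A⁻¹ *ᵥ J))) := by
  rw [cgaussMean, cgaussInt_cexp_neg_dotProduct hAs hA J, mul_comm (Complex.exp _) (cgaussNorm A),
    inv_mul_cancel_left₀ (cgaussNorm_ne_zero hAs hA).1]

omit [DecidableEq Λ] in
/-- The complex Gaussian mean of a CONSTANT is the constant (the normalisation cancels; it is zero-free for a symmetric
precision with positive definite real part). [cite: Balaban1988RG2Cluster, (2.14) p.15] (elementary API for (2.14)) -/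
theorem cgaussMean_const [DecidableEq Λ] {A : Matrix Λ Λ ℂ} (hAs : A.IsSymm) (hA : (A.map Complex.re).PosDef) (c : ℂ) :
    cgaussMean A (fun _ => c) = c := by
  rw [cgaussMean, cgaussInt, integral_mul_const]
  exact inv_mul_cancel_left₀ (cgaussNorm_ne_zero hAs hA).1 c

/-! ## §2. Lines 2–3 of (2.14), and the `X`-integral, of a field-constant last line -/

variable {C₀ : Type} [Fintype C₀]

omit [Fintype C₀] in
/-- **LINES 2–3 OF (2.14) OF A FIELD-CONSTANT LAST LINE ARE THAT CONSTANT**, identically in the white noise `X`: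
`exp(−½⟨ΓX, A⁻¹ΓX⟩)·∫dμ_{A⁻¹}(B) e^{−⟨B,ΓX⟩}·c = c` for a complex symmetric precision with `Re A ≻ 0` — the compensator of
(2.14) cancels the generating function EXACTLY (`B13Term214Centred.integrand214_const_of_mgf` with its hypothesis `hmgf`
discharged by `cgaussMean_cexp_neg_dotProduct`). [cite: Balaban1988RG2Cluster, (2.5)–(2.6) pp.12–13, (2.14) p.15] -/
theorem integrand214_const {A : Matrix Λ Λ ℂ} (hAs : A.IsSymm) (hA : (A.map Complex.re).PosDef)
    (Γ : (Λ ⊕ C₀ → ℝ) → (Λ → ℂ)) (c : ℂ) (X : Λ ⊕ C₀ → ℝ) :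
    integrand214 A Γ (fun _ => c) X = c :=
  integrand214_const_of_mgf A Γ c X (cgaussMean_cexp_neg_dotProduct hAs hA (Γ X))

/-- **THE `X`-INTEGRAL OF (2.14) OF A FIELD-CONSTANT LAST LINE IS THAT CONSTANT**: with the last line `(τ, B) ↦ c(τ)`
(boxes removed, potentials at the background), `∫dμ₀(X)|_Z (lines 2–3) = c(τ)` at every `σ` at which the precision `A(σ)` is
symmetric with positive definite real part (lines 2–3 are the constant by `integrand214_const`; the `dμ₀(X)`-mean of a
constant is the constant). [cite: Balaban1988RG2Cluster, (2.14) p.15, (2.5)–(2.6) pp.12–13] -/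
theorem core214_constLastLine [DecidableEq C₀] {ι D : Type*} (A : (ι → ℂ) → Matrix Λ Λ ℂ)
    (Γ : (ι → ℂ) → (Λ ⊕ C₀ → ℝ) → (Λ → ℂ)) (c : (D → ℂ) → ℂ) (σ : ι → ℂ) (τ : D → ℂ) (hAs : (A σ).IsSymm)
    (hA : ((A σ).map Complex.re).PosDef) :
    core214 A Γ (fun τ _ => c τ) σ τ = c τ := by
  unfold core214
  have h1 : (1 : Matrix (Λ ⊕ C₀) (Λ ⊕ C₀) ℂ).IsSymm := Matrix.isSymm_one
  have h1re : ((1 : Matrix (Λ ⊕ C₀) (Λ ⊕ C₀) ℂ).map Complex.re).PosDef := by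
    rw [Matrix.map_one Complex.re Complex.zero_re Complex.one_re]
    exact Matrix.PosDef.one
  have e : (fun X : Λ ⊕ C₀ → ℝ => integrand214 (A σ) (Γ σ) (fun _ => c τ) X) = fun _ => c τ :=
    funext fun X => integrand214_const hAs hA (Γ σ) (c τ) X
  rw [e]
  exact cgaussMean_const h1 h1re (c τ)

/-! ## §3. The (2.14) term of a field-constant last line vanishes as soon as one `σ(Δ)`-operation is present -/

section Term

variable {E : Type*} [NormedAddCommGroup E] [NormedSpace ℂ E] [CompleteSpace E]
variable {ι : Type*} [DecidableEq ι]

omit [Fintype Λ] [DecidableEq Λ] [Fintype C₀] in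
/-- The printed operator of (2.14) kills a function of NO parameter as soon as one factor
`∫₀¹ds (1/2πi)∮dσ/(σ−s)²` is present — each factor of a constant is `const(1) − const(0) = 0` by
`B13Term214.integral_cauchyD_eq_sub` (the hypothesis-free version is `B13SigmaFreeKernels.TopC_const_of_ne_nil`, not
imported here to keep the `Node00` objects out of this file's closure). [cite: Balaban1988RG2Cluster, (2.14) p.15 (elementary property of the display)] -/
private theorem TopC_const_eq_zero {U : Set ℂ} (hU : IsOpen U) {r : ℝ} (hr : 0 < r)
    (hsub : ∀ s ∈ Set.uIcc (0 : ℝ) 1, closedBall (s : ℂ) r ⊆ U) (e : E) :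
    ∀ {l : List ι}, l ≠ [] → ∀ p : ι → ℂ, TopC r l (fun _ => e) p = 0
  | [], hl, _ => absurd rfl hl
  | i :: l, _, p => by
    by_cases hl' : l = []
    · subst hl'
      simp only [TopC]
      rw [integral_cauchyD_eq_sub hU (differentiableOn_const e) hr hsub, sub_self]
    · have ih : ∀ z : ℂ, TopC r l (fun _ => e) (Function.update p i z) = 0 :=
        fun z => TopC_const_eq_zero hU hr hsub e hl' _
      simp only [TopC, ih]
      rw [integral_cauchyD_eq_sub hU (differentiableOn_const (0 : E)) hr hsub, sub_self]

/-- **THE (2.14) TERM OF A FIELD-CONSTANT LAST LINE VANISHES WHENEVER `Z ∖ Z′₀ ≠ ∅`.**  On an open `U` containing the closed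
`r`-discs about `[0, 1]` (the Cauchy polydisc of (2.14)), if the precision `A(σ) = C^{(k)}(Z₀,σ)⁻¹` is symmetric with positive
definite real part at every admissible `σ` (all coordinates in `U`), then for the last line `(τ, B) ↦ c(τ)` and every
non-empty list of σ-parameters, `term214 r lZ lD (∫dμ₀(X)(lines 2–3)(c)) σ₀ τ₀ = 0`: the `X`-integral is the σ-FREE
function `c(τ)` at every admissible `σ` (`core214_constLastLine`), the printed operator only samples admissible `σ`
(`B13Term214.TopC_congr`), and one σ-factor of a σ-constant is zero.  With `B13Term214CentredPieces.term214_windowDilated_const_eq`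
(the box-free centre is `b`-free) this says: the box-free centre of a σ-CARRYING term of node N22's (S-vertex-T′) is `0`.
[cite: Balaban1988RG2Cluster, (2.14) p.15, (2.8) p.14, (2.5)–(2.6) pp.12–13] -/
theorem term214_constLastLine_eq_zero [DecidableEq C₀] {D : Type*} [DecidableEq D] {U : Set ℂ} (hU : IsOpen U)
    {r : ℝ} (hr : 0 < r) (hsub : ∀ s ∈ Set.uIcc (0 : ℝ) 1, closedBall (s : ℂ) r ⊆ U)
    (A : (ι → ℂ) → Matrix Λ Λ ℂ) (Γ : (ι → ℂ) → (Λ ⊕ C₀ → ℝ) → (Λ → ℂ)) (c : (D → ℂ) → ℂ)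
    (hAs : ∀ σ : ι → ℂ, (∀ j, σ j ∈ U) → (A σ).IsSymm)
    (hA : ∀ σ : ι → ℂ, (∀ j, σ j ∈ U) → ((A σ).map Complex.re).PosDef)
    {lZ : List ι} (hlZ : lZ ≠ []) (lD : List D) {σ₀ : ι → ℂ} (hσ₀ : ∀ j, σ₀ j ∈ U) (τ₀ : D → ℂ) :
    term214 r lZ lD (core214 A Γ (fun τ _ => c τ)) σ₀ τ₀ = 0 := by
  unfold term214
  have hinner : ∀ σ : ι → ℂ, (∀ j, σ j ∈ U) →
      TopC r lD (fun τ => core214 A Γ (fun τ _ => c τ) σ τ) τ₀ = TopC r lD (fun τ => c τ) τ₀ := by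
    intro σ hσ
    have e : (fun τ => core214 A Γ (fun τ _ => c τ) σ τ) = fun τ => c τ :=
      funext fun τ => core214_constLastLine A Γ c σ τ (hAs σ hσ) (hA σ hσ)
    rw [e]
  rw [TopC_congr hr hsub hinner lZ σ₀ hσ₀]
  exact TopC_const_eq_zero hU hr hsub _ hlZ σ₀

/-- Honesty: with NO σ-operation (`Z = Z′₀`, `lZ = []`) the term of a field-constant last line is the τ-operator of `c`
applied at `τ₀` — not zero in general (at admissible `σ₀`). [cite: Balaban1988RG2Cluster, (2.14) p.15 (elementary property of the display)] -/
theorem term214_constLastLine_nil [DecidableEq C₀] {D : Type*} [DecidableEq D] {U : Set ℂ}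
    (A : (ι → ℂ) → Matrix Λ Λ ℂ) (Γ : (ι → ℂ) → (Λ ⊕ C₀ → ℝ) → (Λ → ℂ)) (c : (D → ℂ) → ℂ)
    (hAs : ∀ σ : ι → ℂ, (∀ j, σ j ∈ U) → (A σ).IsSymm)
    (hA : ∀ σ : ι → ℂ, (∀ j, σ j ∈ U) → ((A σ).map Complex.re).PosDef)
    (r : ℝ) (lD : List D) {σ₀ : ι → ℂ} (hσ₀ : ∀ j, σ₀ j ∈ U) (τ₀ : D → ℂ) :
    term214 r [] lD (core214 A Γ (fun τ _ => c τ)) σ₀ τ₀ = TopC r lD (fun τ => c τ) τ₀ := by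
  show TopC r lD (fun τ => core214 A Γ (fun τ _ => c τ) σ₀ τ) τ₀ = _
  have e : (fun τ => core214 A Γ (fun τ _ => c τ) σ₀ τ) = fun τ => c τ :=
    funext fun τ => core214_constLastLine A Γ c σ₀ τ (hAs σ₀ hσ₀) (hA σ₀ hσ₀)
  rw [e]

omit [Fintype Λ] [DecidableEq Λ] [Fintype C₀] in
/-- **The box-free printed last line with field-constant potentials is field-constant**: with `χ = χᶜ = 1` and
`𝐕(Y, B) = O₀(Y)`, `F214 (τ, B) = (−1)^{|P|}·exp(Σ_Y τ(Y)O₀(Y))` for every `B` (the centre's last line in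
`B13Bound226BoxTail` §3 ∕ `B13Term214CentredPieces` §3). [cite: Balaban1988RG2Cluster, (2.14) p.15 (elementary property of the display)] -/
theorem F214_one_one_const {D : Type*} (cardP : ℕ) (Dfam : Finset D) (O₀ : D → ℂ) :
    F214 cardP (fun _ : Λ → ℝ => (1 : ℝ)) (fun _ => (1 : ℝ)) Dfam (fun Y _ => O₀ Y)
      = fun τ _ => (-1) ^ cardP * Complex.exp (∑ Y ∈ Dfam, τ Y * O₀ Y) := by
  funext τ B
  simp only [F214, Complex.ofReal_one, mul_one]

/-- **THE BOX-FREE CENTRE OF A σ-CARRYING TERM IS ZERO** (generic parameter types): on the Cauchy polydisc, with the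
precision symmetric with positive definite real part at every admissible `σ`, the (2.14) term of the box-free last line
with field-constant potentials `O₀` vanishes whenever the σ-list is non-empty (`term214_constLastLine_eq_zero` at the
last line of `F214_one_one_const`). [cite: Balaban1988RG2Cluster, (2.14) p.15, (2.8) p.14, (2.5)–(2.6) pp.12–13] -/
theorem term214_boxFree_eq_zero [DecidableEq C₀] {D : Type*} [DecidableEq D] {U : Set ℂ} (hU : IsOpen U)
    {r : ℝ} (hr : 0 < r) (hsub : ∀ s ∈ Set.uIcc (0 : ℝ) 1, closedBall (s : ℂ) r ⊆ U)
    (A : (ι → ℂ) → Matrix Λ Λ ℂ) (Γ : (ι → ℂ) → (Λ ⊕ C₀ → ℝ) → (Λ → ℂ))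
    (cardP : ℕ) (Dfam : Finset D) (O₀ : D → ℂ)
    (hAs : ∀ σ : ι → ℂ, (∀ j, σ j ∈ U) → (A σ).IsSymm)
    (hA : ∀ σ : ι → ℂ, (∀ j, σ j ∈ U) → ((A σ).map Complex.re).PosDef)
    {lZ : List ι} (hlZ : lZ ≠ []) (lD : List D) {σ₀ : ι → ℂ} (hσ₀ : ∀ j, σ₀ j ∈ U) (τ₀ : D → ℂ) :
    term214 r lZ lD (core214 A Γ (F214 cardP (fun _ => (1 : ℝ)) (fun _ => (1 : ℝ)) Dfam (fun Y _ => O₀ Y))) σ₀ τ₀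
      = 0 := by
  rw [F214_one_one_const]
  exact term214_constLastLine_eq_zero hU hr hsub A Γ (fun τ => (-1) ^ cardP * Complex.exp (∑ Y ∈ Dfam, τ Y * O₀ Y))
    hAs hA hlZ lD hσ₀ τ₀

end Term

/-! ## §4. On the torus, along the window-dilated family: the box-free centre of a σ-carrying term is `0` for EVERY
member of the ball, from the PRIMITIVE letters at `b = 1` -/

section Torus

variable {d N' : ℕ}
variable {ν : ℕ} {Nf : Fin ν → ℕ} [∀ i, NeZero (Nf i)]

open B13PerturbativeStep (WeightHyp)
open B13Bound226Located (hR2_of_entrywise entry_bound_mono_rate)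
open B13Lemma3TorusPrimitive (weightHyp_tdist1 tdist1_symm kc_tdist1)
open B13Term214WindowDilated (posDef_re_of_form sq_smul_sub_entry_le theta_mul_lt_one)
open B13CauchyDecay (closedBall_subset_closedBall_of_mem_uIcc)
open TreeLengthTorus (TPt)
open B5TorusCover (UT)
open B9Thm37GlueTorus (tdist1)

/-- **THE BOX-FREE CENTRE OF A σ-CARRYING TERM VANISHES ALONG THE WHOLE WINDOW-DILATED FAMILY, from the PRIMITIVE letters
at `b = 1`** (the VALUE of node N22's coupling-blind centre per term: `B13Bound226BoxTail.term214_torus_windowDilated_boxFree_eq_of_primitives`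
proved it `b`-free from radial invariance + holomorphy; here it is `0`, from the Gaussian translation, for every member `b`
of the ball `|b − 1| < ρ_b < 1` separately — no holomorphy in `b` needed).  Hypotheses: the SUBSET of that theorem's letters
which make `Re(b²A(σ)) ≻ 0` on the σ-polydisc (symmetry of `A(σ)`; the reference covariance `C ≻ 0` with `λ(C) ≤ c_E`; the
E-letter `‖A(σ) − C⁻¹‖ ≤ θ_E e^{−κd}` and `K_E`; the primed letter `θ_E′ ≥ θ_E + ρ_b(2 + ρ_b)(θ_E + K_E)`, `θ_E′ ≤ θ`; the
multiplicity `m` of the bond locations; `(2θ(m(1 + 2/κ″))^ν + α)·c_E ≤ ½` — exactly the block module 41 uses), the Cauchy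
radius `r ≤ e^{κ₁} − 1` inside the polydisc `|σ| ≤ e^{κ₁} ⊆ Uσ`, and a NON-EMPTY σ-list. [cite: Balaban1988RG2Cluster, (2.14)–(2.15) p.15, (2.16) p.16, (2.24) p.17, (2.5)–(2.6) pp.12–13; Balaban1987RG1, (2.10)-(2.13) pp.266-268] -/
theorem term214_torus_windowDilated_boxFree_eq_zero_of_primitives [DecidableEq C₀] (c : B13.Consts) {D : Type*}
    [DecidableEq D]
    {Uσ : Set ℂ} (hUσ : IsOpen Uσ) (hUexp : closedBall (0 : ℂ) (Real.exp c.κ₁) ⊆ Uσ)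
    {r : ℝ} (hr : 0 < r) (hr' : r ≤ Real.exp c.κ₁ - 1)
    {lZ : List (TPt d N')} (hlZ : lZ ≠ []) (lD : List D)
    (A : (TPt d N' → ℂ) → Matrix Λ Λ ℂ) (Γ : (TPt d N' → ℂ) → (Λ ⊕ C₀ → ℝ) → (Λ → ℂ))
    (cardP : ℕ) (Dfam : Finset D) (O₀ : D → ℂ)
    {C : Matrix Λ Λ ℝ} (hC : C.PosDef)
    (hAs : ∀ σ : TPt d N' → ℂ, (∀ j, σ j ∈ Uσ) → (A σ).IsSymm)
    (locΛ : Λ → UT Nf) {m : ℕ} (hfibΛ : ∀ x : UT Nf, (Finset.univ.filter fun i => locΛ i = x).card ≤ m)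
    {kap kap'' θ θE KE : ℝ} (hkap'' : 0 < kap'') (hkk : kap'' ≤ kap) (hθE : 0 ≤ θE) (hKE : 0 ≤ KE)
    (hCE : ∀ b b', ‖(C⁻¹.map (algebraMap ℝ ℂ)) b b'‖ ≤ KE * Real.exp (-(kap * tdist1 Nf (locΛ b) (locΛ b'))))
    (hdE : ∀ σ : TPt d N' → ℂ, (∀ j, σ j ∈ Uσ) →
      ∀ b b', ‖(A σ - C⁻¹.map (algebraMap ℝ ℂ)) b b'‖ ≤ θE * Real.exp (-(kap * tdist1 Nf (locΛ b) (locΛ b'))))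
    {ρb θE' : ℝ} (hθE' : θE + ρb * (2 + ρb) * (θE + KE) ≤ θE') (hθEle : θE' ≤ θ)
    {cE α : ℝ} (hc0 : 0 ≤ cE) (hc : ∀ k, hC.1.eigenvalues k ≤ cE) (hα : 0 ≤ α)
    (hαc : (2 * (θ * (m * (1 + 2 / kap'') ^ ν)) + α) * cE ≤ 1 / 2) :
    ∀ b ∈ ball (1 : ℂ) ρb,
      term214 r lZ lD (core214 (fun σ => b ^ 2 • A σ) (fun σ X => b • Γ σ X)
        (F214 cardP (fun _ => (1 : ℝ)) (fun _ => (1 : ℝ)) Dfam (fun Y _ => O₀ Y))) 0 0 = 0 := by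
  intro b hb
  have hρb0 : 0 ≤ ρb := (dist_nonneg.trans_lt (mem_ball.1 hb)).le
  have hexp : ∀ x : ℝ, 0 ≤ Real.exp x := fun x => (Real.exp_pos x).le
  have hθE'0 : 0 ≤ θE' := le_trans (by positivity) hθE'
  have hθ : 0 ≤ θ := hθE'0.trans hθEle
  -- the Cauchy discs about `[0, 1]` lie in the σ-polydisc; the base point `σ₀ = 0` is admissible
  have hsub : ∀ s ∈ Set.uIcc (0 : ℝ) 1, closedBall (s : ℂ) r ⊆ Uσ := fun s hs =>
    (closedBall_subset_closedBall_of_mem_uIcc hr' hs).trans hUexp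
  have hσ₀ : ∀ j : TPt d N', (0 : TPt d N' → ℂ) j ∈ Uσ := fun _ =>
    hUexp (mem_closedBall_self (Real.exp_pos _).le)
  -- `Re(b²A(σ)) ≻ 0` on the σ-polydisc, from the transported E-letter (module 41's derivation, verbatim)
  have hdE' : ∀ σ : TPt d N' → ℂ, (∀ j, σ j ∈ Uσ) →
      ∀ i j, ‖(b ^ 2 • A σ - C⁻¹.map (algebraMap ℝ ℂ)) i j‖
        ≤ θE' * Real.exp (-(kap * tdist1 Nf (locΛ i) (locΛ j))) := fun σ hσ i j =>
    (sq_smul_sub_entry_le hCE (hdE σ hσ) hb i j).trans (mul_le_mul_of_nonneg_right hθE' (hexp _))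
  have hA' : ∀ σ : TPt d N' → ℂ, (∀ j, σ j ∈ Uσ) → ((b ^ 2 • A σ).map Complex.re).PosDef := by
    intro σ hσ
    have h216E : ∀ i j, ‖(b ^ 2 • A σ - C⁻¹.map (algebraMap ℝ ℂ)) i j‖
        ≤ θ * Real.exp (-(kap'' * tdist1 Nf (locΛ i) (locΛ j))) := fun i j =>
      (entry_bound_mono_rate (weightHyp_tdist1 (N := Nf)) hθE'0 hkk locΛ locΛ (hdE' σ hσ) i j).trans
        (mul_le_mul_of_nonneg_right hθEle (hexp _))
    refine posDef_re_of_form ((hAs σ hσ).smul _) hC hc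
      (hR2_of_entrywise (weightHyp_tdist1 (N := Nf)) tdist1_symm kc_tdist1 hθ hkap'' locΛ hfibΛ h216E) ?_
    exact theta_mul_lt_one le_rfl hα hc0 (by simpa only [zero_add] using hαc)
  exact term214_boxFree_eq_zero hUσ hr hsub (fun σ => b ^ 2 • A σ) (fun σ X => b • Γ σ X) cardP Dfam O₀
    (fun σ hσ => (hAs σ hσ).smul _) hA' hlZ lD hσ₀ 0

end Torus

/-! ## §5 (v1.1, append-only). The centre of a PURE MAYER term (`Z = Z′₀`, no σ-operation) is the zero-coupling Mayer
product of the older terms at the background (lens Card T22, second half)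

LOCATOR NOTE (lit-balaban desk, ME #27, 2026-08-27T16:14Z, lead g27 ∕ r10 g49 ∕ typer g44, concordant): the complex-precision
translation identity of §1 is STATED AND CITED NOWHERE in [I]–[III], CMP 122 I∕II, [13], [15], [16] — print translates at REAL
data ((2.5) p.12 l.21 via «(2.28) [6]» = Bałaban, (Higgs)₂,₃ II, CMP 86 (1982) p.563, a positive operator; and once more as the
evaluation (2.24) p.17 of the `B`-integral of (2.23), real `J = Γ_k(Z₀,0)X`, tree `B13Integral223.innerB_eq_224`), inserts the
parameters `s` into the operators of the already-translated display ((2.8) p.13), continues `s ↦ σ` by the Cauchy formula ((2.14)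
p.15) and DOMINATES the complex measure ((2.15)) — it never translates it.  The tree needs the identity because `B13Term214` types
lines 2–3 of (2.14) as literal complex Gaussian integrals; [HormanderALPDO1, Thm 7.6.1] is the locator of record. -/

section Mayer

variable {ι : Type*} [DecidableEq ι]

open B13Term214 (DopC SepHolOn TopC_eq_DopC)
open B13Representation214 (DopC_const_mul DopC_cexp_sum)

omit [Fintype Λ] [DecidableEq Λ] [Fintype C₀] in
/-- The box-free last line's τ-function `τ ↦ (−1)^{|P|}·exp(Σ_{Y∈𝐃} τ(Y)O₀(Y))` is separately holomorphic in every `τ(Y)` on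
all of `ℂ` (an exponential of an affine function). [cite: Balaban1988RG2Cluster, (2.14) p.15 (elementary property of the display)] -/
theorem sepHolOn_boxFree_const {D : Type*} [DecidableEq D] (cardP : ℕ) (Dfam : Finset D) (O₀ : D → ℂ) :
    SepHolOn (Set.univ : Set ℂ) (fun τ : D → ℂ => (-1 : ℂ) ^ cardP * Complex.exp (∑ Y ∈ Dfam, τ Y * O₀ Y)) := by
  intro Y p _
  refine ((DifferentiableOn.fun_sum fun Y' _ => ?_).cexp).const_mul _
  by_cases h : Y' = Y
  · subst h
    simp only [Function.update_self]
    exact (differentiableOn_id.mul_const _)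
  · simp only [Function.update_of_ne h]
    exact differentiableOn_const _

/-- **THE CENTRE OF A PURE MAYER TERM IS THE ZERO-COUPLING MAYER PRODUCT** (lens Card T22, second half): with NO σ-operation
(`Z = Z′₀`, `lZ = []`), the box-free last line with field-constant potentials `O₀(Y)` (the older terms at the background) summed
over the τ-family `𝐃 = lD`, and the precision at the base point `σ₀` symmetric with positive definite real part, the (2.14) term
equals `(−1)^{|P|} · Π_{Y∈𝐃} (e^{O₀(Y)} − 1)` — the `𝐃`-term of the Mayer expansion (2.1) of the older terms at zero coupling:
the `X`-integral is the τ-function `(−1)^{|P|}e^{Σ τ(Y)O₀(Y)}` (`core214_constLastLine`), the printed τ-operators are the corner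
differences (`B13Term214.TopC_eq_DopC`, the function being entire), and `D^τ_𝐃 e^{Σ τ O₀} = Π(e^{O₀} − 1)`
(`B13Representation214.DopC_cexp_sum`).  Together with `term214_boxFree_eq_zero` (σ-carrying terms: centre `0`) this is the VALUE
of node N22's coupling-blind centre `V` term by term. [cite: Balaban1988RG2Cluster, (2.1) p.12, (2.14) p.15, (2.5)–(2.6) pp.12–13, (2.24) p.17] -/
theorem term214_boxFree_nil_eq_mayerProduct [DecidableEq C₀] {D : Type*} [DecidableEq D]
    (A : (ι → ℂ) → Matrix Λ Λ ℂ) (Γ : (ι → ℂ) → (Λ ⊕ C₀ → ℝ) → (Λ → ℂ)) (cardP : ℕ) (O₀ : D → ℂ)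
    {σ₀ : ι → ℂ} (hAs : (A σ₀).IsSymm) (hA : ((A σ₀).map Complex.re).PosDef)
    {r : ℝ} (hr : 0 < r) {lD : List D} (hlD : lD.Nodup) (τ₀ : D → ℂ) :
    term214 r [] lD (core214 A Γ (F214 cardP (fun _ => (1 : ℝ)) (fun _ => (1 : ℝ)) lD.toFinset (fun Y _ => O₀ Y))) σ₀ τ₀
      = (-1) ^ cardP * ∏ Y ∈ lD.toFinset, (Complex.exp (O₀ Y) - 1) := by
  rw [F214_one_one_const]
  show TopC r lD (fun τ => core214 A Γ (fun τ _ => (-1) ^ cardP * Complex.exp (∑ Y ∈ lD.toFinset, τ Y * O₀ Y)) σ₀ τ) τ₀ = _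
  have e : (fun τ => core214 A Γ (fun τ _ => (-1) ^ cardP * Complex.exp (∑ Y ∈ lD.toFinset, τ Y * O₀ Y)) σ₀ τ)
      = fun τ => (-1 : ℂ) ^ cardP * Complex.exp (∑ Y ∈ lD.toFinset, τ Y * O₀ Y) :=
    funext fun τ => core214_constLastLine A Γ _ σ₀ τ hAs hA
  rw [e, TopC_eq_DopC isOpen_univ hr (fun _ _ => Set.subset_univ _) (sepHolOn_boxFree_const cardP lD.toFinset O₀) lD hlD τ₀
    (fun _ => Set.mem_univ _), DopC_const_mul, DopC_cexp_sum]

end Mayer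

/-! ## §6 (v1.1, append-only). On the torus, along the window-dilated family: the centre of a pure Mayer term is the
zero-coupling Mayer product for EVERY member of the ball -/

section TorusMayer

variable {d N' : ℕ}
variable {ν : ℕ} {Nf : Fin ν → ℕ} [∀ i, NeZero (Nf i)]

open B13PerturbativeStep (WeightHyp)
open B13Bound226Located (hR2_of_entrywise entry_bound_mono_rate)
open B13Lemma3TorusPrimitive (weightHyp_tdist1 tdist1_symm kc_tdist1)
open B13Term214WindowDilated (posDef_re_of_form sq_smul_sub_entry_le theta_mul_lt_one)
open TreeLengthTorus (TPt)
open B5TorusCover (UT)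
open B9Thm37GlueTorus (tdist1)

/-- **THE CENTRE OF A PURE MAYER TERM ALONG THE WINDOW-DILATED FAMILY IS THE ZERO-COUPLING MAYER PRODUCT, for every member
`b` of the ball** (the `lZ = []` companion of `term214_torus_windowDilated_boxFree_eq_zero_of_primitives`, same letters): with no
σ-operation the window-dilated member `term(b²A, bΓ, F214 1 1 𝐃 O₀)` equals `(−1)^{|P|}·Π_{Y∈𝐃}(e^{O₀(Y)} − 1)` — explicitly
`b`-FREE with its value (`term214_boxFree_nil_eq_mayerProduct` at the base point `σ₀ = 0`, where `Re(b²A(0)) ≻ 0` by module 41's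
derivation from the E-letter). [cite: Balaban1988RG2Cluster, (2.1) p.12, (2.14)–(2.15) p.15, (2.16) p.16, (2.5)–(2.6) pp.12–13; Balaban1987RG1, (2.10)-(2.13) pp.266-268] -/
theorem term214_torus_windowDilated_boxFree_nil_eq_mayerProduct_of_primitives [DecidableEq C₀] (c : B13.Consts)
    {D : Type*} [DecidableEq D]
    {Uσ : Set ℂ} (hUexp : closedBall (0 : ℂ) (Real.exp c.κ₁) ⊆ Uσ) {r : ℝ} (hr : 0 < r) {lD : List D} (hlD : lD.Nodup)
    (A : (TPt d N' → ℂ) → Matrix Λ Λ ℂ) (Γ : (TPt d N' → ℂ) → (Λ ⊕ C₀ → ℝ) → (Λ → ℂ))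
    (cardP : ℕ) (O₀ : D → ℂ)
    {C : Matrix Λ Λ ℝ} (hC : C.PosDef)
    (hAs : ∀ σ : TPt d N' → ℂ, (∀ j, σ j ∈ Uσ) → (A σ).IsSymm)
    (locΛ : Λ → UT Nf) {m : ℕ} (hfibΛ : ∀ x : UT Nf, (Finset.univ.filter fun i => locΛ i = x).card ≤ m)
    {kap kap'' θ θE KE : ℝ} (hkap'' : 0 < kap'') (hkk : kap'' ≤ kap) (hθE : 0 ≤ θE) (hKE : 0 ≤ KE)
    (hCE : ∀ b b', ‖(C⁻¹.map (algebraMap ℝ ℂ)) b b'‖ ≤ KE * Real.exp (-(kap * tdist1 Nf (locΛ b) (locΛ b'))))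
    (hdE : ∀ σ : TPt d N' → ℂ, (∀ j, σ j ∈ Uσ) →
      ∀ b b', ‖(A σ - C⁻¹.map (algebraMap ℝ ℂ)) b b'‖ ≤ θE * Real.exp (-(kap * tdist1 Nf (locΛ b) (locΛ b'))))
    {ρb θE' : ℝ} (hθE' : θE + ρb * (2 + ρb) * (θE + KE) ≤ θE') (hθEle : θE' ≤ θ)
    {cE α : ℝ} (hc0 : 0 ≤ cE) (hc : ∀ k, hC.1.eigenvalues k ≤ cE) (hα : 0 ≤ α)
    (hαc : (2 * (θ * (m * (1 + 2 / kap'') ^ ν)) + α) * cE ≤ 1 / 2) (τ₀ : D → ℂ) :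
    ∀ b ∈ ball (1 : ℂ) ρb,
      term214 r [] lD (core214 (fun σ => b ^ 2 • A σ) (fun σ X => b • Γ σ X)
        (F214 cardP (fun _ => (1 : ℝ)) (fun _ => (1 : ℝ)) lD.toFinset (fun Y _ => O₀ Y))) 0 τ₀
        = (-1) ^ cardP * ∏ Y ∈ lD.toFinset, (Complex.exp (O₀ Y) - 1) := by
  intro b hb
  have hρb0 : 0 ≤ ρb := (dist_nonneg.trans_lt (mem_ball.1 hb)).le
  have hexp : ∀ x : ℝ, 0 ≤ Real.exp x := fun x => (Real.exp_pos x).le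
  have hθE'0 : 0 ≤ θE' := le_trans (by positivity) hθE'
  have hθ : 0 ≤ θ := hθE'0.trans hθEle
  have hσ₀ : ∀ j : TPt d N', (0 : TPt d N' → ℂ) j ∈ Uσ := fun _ =>
    hUexp (mem_closedBall_self (Real.exp_pos _).le)
  -- `Re(b²A(0)) ≻ 0` from the transported E-letter (module 41's derivation, verbatim, at the base point)
  have hdE' : ∀ i j, ‖(b ^ 2 • A 0 - C⁻¹.map (algebraMap ℝ ℂ)) i j‖
      ≤ θE' * Real.exp (-(kap * tdist1 Nf (locΛ i) (locΛ j))) := fun i j =>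
    (sq_smul_sub_entry_le hCE (hdE 0 hσ₀) hb i j).trans (mul_le_mul_of_nonneg_right hθE' (hexp _))
  have h216E : ∀ i j, ‖(b ^ 2 • A 0 - C⁻¹.map (algebraMap ℝ ℂ)) i j‖
      ≤ θ * Real.exp (-(kap'' * tdist1 Nf (locΛ i) (locΛ j))) := fun i j =>
    (entry_bound_mono_rate (weightHyp_tdist1 (N := Nf)) hθE'0 hkk locΛ locΛ hdE' i j).trans
      (mul_le_mul_of_nonneg_right hθEle (hexp _))
  have hA' : ((b ^ 2 • A 0).map Complex.re).PosDef :=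
    posDef_re_of_form ((hAs 0 hσ₀).smul _) hC hc
      (hR2_of_entrywise (weightHyp_tdist1 (N := Nf)) tdist1_symm kc_tdist1 hθ hkap'' locΛ hfibΛ h216E)
      (theta_mul_lt_one le_rfl hα hc0 (by simpa only [zero_add] using hαc))
  exact term214_boxFree_nil_eq_mayerProduct (fun σ => b ^ 2 • A σ) (fun σ X => b • Γ σ X) cardP O₀ ((hAs 0 hσ₀).smul _)
    hA' hr hlD τ₀

end TorusMayer

end Literature.MathematicalPhysics.QuantumFieldTheory.Balaban1983to89.B13Term214GaussShift

end
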